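import Summits.HodgeConjecture.CorCM.OcticCMFieldPrimeToThreeAllTypes
import Mathlib.NumberTheory.Cyclotomic.Gal
import HarnessLib

/-!
# Weil-type family coverage — HC STATUS AT THE CYCLOTOMIC CM FOURFOLDS (the `(c3)` column at `g = 4`): the Hodge
# conjecture holds, UNCONDITIONALLY, for every power of EVERY abelian fourfold realising a CM type of `ℚ(ζ₁₅)`,
# `ℚ(ζ₁₆)`, `ℚ(ζ₂₀)` or `ℚ(ζ₂₄)` — simple or not, Weil type or not (COR-CM's prime-to-`3` octic theorem at `L = K`)

research route conditional on HC_CM; not a corollary; Q11.4-sentence-2 already refuted in dim ≥ 3.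

Ring 2, WEIL-TYPE FAMILY-COVERAGE CENSUS (`HOME/WEIL-FAMILY-COVERAGE.md` `## b01`, block b01.46 «the cyclotomic CM
FOURFOLDS of Weil type», column (c3) «CM points of record, with HC status and SOURCE class»; owner ring2-b01), part 79
of the `Ring2WeilCoverage*` series.  Parts 75–78 located the Weil-type CM fourfolds with multiplication by `ℤ[ζ_M]`,
`M ∈ {15, 16, 20, 24}` (their `ι`-compatible polarisation types; non-simplicity).  Their HC STATUS is a TREE theorem:
COR-CM's `OcticPrimeToThreeAllTypes.hodgeConjectureFor_pow_octic_of_embedding` (binder seat b04 gen 21: an octic CM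
field `K` embedded in a Galois CM field `L` with `3 ∤ [L:ℚ]` ⟹ every abelian fourfold with multiplication by `K` is
stably nondegenerate — Dodson §3.3.2 for the simple ones, Ribet's primitive core for the others) applies with
`L = K = ℚ(ζ_M)` itself: `K` is Galois (Mathlib `IsCyclotomicExtension.isGalois`) of degree `φ(M) = 8`, prime to `3`.
The COR-CM lane instantiated the levels only for SIMPLE realisations unconditionally
(`CyclotomicRank.hodgeConjectureFor_pow_of_isSimple_M`) and for all realisations MODULO Aoki's theorem
(`CyclotomicSlice.hodgeConjectureFor_of_embedding_cyclotomic_M (hAoki)`); here the four hypothesis-free all-types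
instances, which cover exactly the NON-simple Weil-type points of parts 75–78:

* `hodgeConjectureFor_pow_fifteen/_sixteen/_twenty/_twentyFour` — for any `K` with `IsCyclotomicExtension {M} ℚ K`,
  `[IsCMField K]`, ANY CM type `Φ` and ANY realisation `(A, ι, θ)` of `(K; Φ)`: `HodgeConjectureFor` holds for the
  power `⨁_{Fin N} A`, every `N` (the power form of the COR-CM theorem; `finrank_eq_eight_M` discharges `[K:ℚ] = 8`).

HONEST FRAMING: these ARE cases of the Hodge conjecture — at specific CM abelian varieties (dimension-`0` loci of the
`g = 4` Weil components), as UNCONDITIONAL tree theorems assembled from COR-CM (Dodson 1984, Kubota 1965, Ribet, Shimura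
§8.2 Prop. 26, Moonen–Zarhin); nothing about general members or `W_K` on a positive-dimensional family; `HC_CM`
(`Theses.RankFourFaces.CMAbelianHodge`) is used nowhere.  No `def`, no named fact, no `sorry`.

References: [cite: Dodson1984, §3.3.2 Theorem]; [cite: Kubota1965, §2]; [cite: Gordon1999HodgeAVSurvey, Thm. 6.3–6.4];
census b01.46 (seat-derived).
-/

noncomputable section

open CategoryTheory CategoryTheory.Limits NumberField

namespace Summit.HodgeConjecture.Ring2WeilCoverage.CyclotomicFourfoldsHodge

open Literature.AlgebraicGeometry Literature.AlgebraicGeometry.Motives Literature.AlgebraicGeometry.HodgeTheory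
open Literature.AlgebraicGeometry.ComplexMultiplication (IsCMTypeRealisation)
open Summit.HodgeConjecture.CorCM.OcticPrimeToThreeAllTypes (hodgeConjectureFor_pow_octic_of_embedding)

variable {K : Type} [Field K] [NumberField K] [IsCMField K]
  {Φ : CMType K} {A : AbelianVariety ℂ} {ι : 𝓞 K →+* End A} {θ : K →+* Module.End ℂ (complexBetti A.X 1)}

omit [IsCMField K] in
/-- `[ℚ(ζ_M) : ℚ] = 8` for `M ∈ {15, 16, 20, 24}` — here `15`. [folklore] -/
theorem finrank_eq_eight_fifteen [IsCyclotomicExtension {15} ℚ K] : Module.finrank ℚ K = 8 := by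
  rw [IsCyclotomicExtension.finrank K (Polynomial.cyclotomic.irreducible_rat (by norm_num : 0 < 15))]; decide

omit [IsCMField K] in
/-- `[ℚ(ζ₁₆) : ℚ] = 8`. [folklore] -/
theorem finrank_eq_eight_sixteen [IsCyclotomicExtension {16} ℚ K] : Module.finrank ℚ K = 8 := by
  rw [IsCyclotomicExtension.finrank K (Polynomial.cyclotomic.irreducible_rat (by norm_num : 0 < 16))]; decide

omit [IsCMField K] in
/-- `[ℚ(ζ₂₀) : ℚ] = 8`. [folklore] -/
theorem finrank_eq_eight_twenty [IsCyclotomicExtension {20} ℚ K] : Module.finrank ℚ K = 8 := by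
  rw [IsCyclotomicExtension.finrank K (Polynomial.cyclotomic.irreducible_rat (by norm_num : 0 < 20))]; decide

omit [IsCMField K] in
/-- `[ℚ(ζ₂₄) : ℚ] = 8`. [folklore] -/
theorem finrank_eq_eight_twentyFour [IsCyclotomicExtension {24} ℚ K] : Module.finrank ℚ K = 8 := by
  rw [IsCyclotomicExtension.finrank K (Polynomial.cyclotomic.irreducible_rat (by norm_num : 0 < 24))]; decide

/-- **HC FOR EVERY POWER OF EVERY ABELIAN FOURFOLD WITH COMPLEX MULTIPLICATION BY `ℚ(ζ₁₅)`, UNCONDITIONALLY.**  For any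
`K` with `IsCyclotomicExtension {15} ℚ K`, `[IsCMField K]`, ANY CM type `Φ` of `K` (primitive or not, `ℚ(√−15)`- /
`ℚ(√−3)`-balanced or not) and ANY realisation `(A, ι, θ)` of `(K; Φ)`: the Hodge conjecture holds for `A^N`, all `N`
(COR-CM `hodgeConjectureFor_pow_octic_of_embedding` at `L = K`: `K/ℚ` Galois of degree `8`, `3 ∤ 8`).  In particular
at the NON-simple Weil-type points `ℂ^Φ/Φ(ℤ[ζ₁₅])` of parts 75/77/78 (the NO rows `(15, ℚ(√−15))`, `(15, ℚ(√−3))`).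
research route conditional on HC_CM; not a corollary; Q11.4-sentence-2 already refuted in dim ≥ 3. [cite: Dodson1984, §3.3.2 Theorem] [cite: Gordon1999HodgeAVSurvey, Thm. 6.3–6.4] -/
theorem hodgeConjectureFor_pow_fifteen [IsCyclotomicExtension {15} ℚ K] (hA : IsCMTypeRealisation Φ A ι θ) (N : ℕ) :
    HodgeConjectureFor (⨁ fun _ : Fin N => A).dim (⨁ fun _ : Fin N => A).X := by
  haveI := IsCyclotomicExtension.isGalois {15} ℚ K
  exact hodgeConjectureFor_pow_octic_of_embedding finrank_eq_eight_fifteen (AlgHom.id ℚ K)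
    (by rw [finrank_eq_eight_fifteen (K := K)]; decide) hA N

/-- **HC FOR EVERY POWER OF EVERY ABELIAN FOURFOLD WITH COMPLEX MULTIPLICATION BY `ℚ(ζ₁₆)`, UNCONDITIONALLY** (any
type, any realisation; in particular the Weil-type points of part 76's rows `(16, ℚ(i))`, `(16, ℚ(√−2))`).
research route conditional on HC_CM; not a corollary; Q11.4-sentence-2 already refuted in dim ≥ 3. [cite: Dodson1984, §3.3.2 Theorem] [cite: Gordon1999HodgeAVSurvey, Thm. 6.3–6.4] -/
theorem hodgeConjectureFor_pow_sixteen [IsCyclotomicExtension {16} ℚ K] (hA : IsCMTypeRealisation Φ A ι θ) (N : ℕ) :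
    HodgeConjectureFor (⨁ fun _ : Fin N => A).dim (⨁ fun _ : Fin N => A).X := by
  haveI := IsCyclotomicExtension.isGalois {16} ℚ K
  exact hodgeConjectureFor_pow_octic_of_embedding finrank_eq_eight_sixteen (AlgHom.id ℚ K)
    (by rw [finrank_eq_eight_sixteen (K := K)]; decide) hA N

/-- **HC FOR EVERY POWER OF EVERY ABELIAN FOURFOLD WITH COMPLEX MULTIPLICATION BY `ℚ(ζ₂₀)`, UNCONDITIONALLY** (any
type, any realisation; in particular the Weil-type points of part 75's rows `(20, ℚ(i))`, `(20, ℚ(√−5))`).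
research route conditional on HC_CM; not a corollary; Q11.4-sentence-2 already refuted in dim ≥ 3. [cite: Dodson1984, §3.3.2 Theorem] [cite: Gordon1999HodgeAVSurvey, Thm. 6.3–6.4] -/
theorem hodgeConjectureFor_pow_twenty [IsCyclotomicExtension {20} ℚ K] (hA : IsCMTypeRealisation Φ A ι θ) (N : ℕ) :
    HodgeConjectureFor (⨁ fun _ : Fin N => A).dim (⨁ fun _ : Fin N => A).X := by
  haveI := IsCyclotomicExtension.isGalois {20} ℚ K
  exact hodgeConjectureFor_pow_octic_of_embedding finrank_eq_eight_twenty (AlgHom.id ℚ K)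
    (by rw [finrank_eq_eight_twenty (K := K)]; decide) hA N

/-- **HC FOR EVERY POWER OF EVERY ABELIAN FOURFOLD WITH COMPLEX MULTIPLICATION BY `ℚ(ζ₂₄)`, UNCONDITIONALLY** (any
type, any realisation; in particular the Weil-type points of part 75's rows `(24, ℚ(i))`, `(24, ℚ(√−2))`,
`(24, ℚ(√−3))`, `(24, ℚ(√−6))`).
research route conditional on HC_CM; not a corollary; Q11.4-sentence-2 already refuted in dim ≥ 3. [cite: Dodson1984, §3.3.2 Theorem] [cite: Gordon1999HodgeAVSurvey, Thm. 6.3–6.4] -/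
theorem hodgeConjectureFor_pow_twentyFour [IsCyclotomicExtension {24} ℚ K] (hA : IsCMTypeRealisation Φ A ι θ)
    (N : ℕ) : HodgeConjectureFor (⨁ fun _ : Fin N => A).dim (⨁ fun _ : Fin N => A).X := by
  haveI := IsCyclotomicExtension.isGalois {24} ℚ K
  exact hodgeConjectureFor_pow_octic_of_embedding finrank_eq_eight_twentyFour (AlgHom.id ℚ K)
    (by rw [finrank_eq_eight_twentyFour (K := K)]; decide) hA N

end Summit.HodgeConjecture.Ring2WeilCoverage.CyclotomicFourfoldsHodge

end
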